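import Summits.QuantumFields.YangMills.Theorems.UnitScaleTiltProp7ConjFrameTransport
import HarnessLib

/-!
# Route `UnitScaleTilt`, crux K1 «MinimiserStabilityRegPr» (stmt-QuantumFields-19200), route-R E′ path (α′), S3 K-form engine, row (R4′) — FILE 9d (abstract letters):
# THE COMMUTATOR CURRENCY `N_m(g) = ‖g·m − m·g‖` ON BI-CONTRACTIVE UNITS AND THE CHAIN RULE `N_m(Π_k T_kP_kT_k⁻¹) ≤ Σ_k N_(Ad(T_k⁻¹)m)(P_k)` —
# the swap∕Stokes calculus of ✓ `LatticeWordStokes` re-run with `dist1` replaced by the commutator with a FIXED element `m`, so that a loop holonomy acting on `m` is booked by the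
# commutators of `m` (transported) with the plaquettes the loop sweeps, NOT by the loop's size times `‖m‖`

Cell `ym3-torus`, D-0154 (3c) twin-width seat `ym-routeR-w1` (gen 6); row (R4′) «framed-constant models in commutator currency» (namer ★ym-ust-19200-p1 g15, 2026-08-28 20:45Z;
LOCATE `ym-routeR-w1/LOCATE-R4PRIME-routeRw1g6.md`, 19200 evidence #44, §3 «the one new letter»).  THEOREMS ONLY (0 `def`, 0 `sorry`); `--supports stmt-QuantumFields-19200`,
count-neutral.  YM₃ on T³ is a ladder rung (R3), not the Clay problem; nothing here claims a stub, the crux, d = 4 or the mass gap.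

WHY.  In ✓ `Prop7LemmaHCurvedOfLocalModels.lemmaH_curved_of_localModels` (F-H9b) with the comb∕axial local model `Ψ_y = R((axialT W c_y ·)⁻¹)m_y` the covariant derivative is
`R(axialT⁻¹)(R(h)m_y − m_y)` with `h` a thin loop holonomy (✓ `B10Eq27TorusAxialLog.holT_contourT`), and `‖R(h)m − m‖ ≤ N_m(h)`.  A thin loop is a product of conjugated plaquettes
`h = Π_k T_kP_kT_k⁻¹` (one plaquette per rung); the rows of §1 turn `N_m(h)` into `Σ_k N_(T_k⁻¹mT_k)(P_k)` — commutators of the TRANSPORTED `m` with the plaquettes — which is the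
(Kg) currency `Σ_p‖[W(∂p), φ₀(x_p)]‖²` of the K-form engine after the junction `‖[P, m̃]‖ ≤ ‖[P, φ₀(x_p)]‖ + 2‖P − 1‖·‖m̃ − φ₀(x_p)‖` (§1 `comm_le_comm_add`).  This replaces the
absolute bound `‖R(h)m − m‖ ≤ 2·dist(h,1)·‖m̊‖` (alignment-blind) used by F-H4∕F-H5b∕F-H8.
WHAT IS PROVED (ns `…Theorems.Prop7CommutatorChain`; `𝔸` a normed ring; «bi-contractive» = `‖u‖ ≤ 1 ∧ ‖u⁻¹‖ ≤ 1`).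
* §1 the currency: `comm_one` · ★ `comm_mul_le` (`N_m(uv) ≤ N_m(u) + N_m(v)`) · `comm_inv_le` (`N_m(u⁻¹) ≤ N_m(u)`) · ★ `comm_conj_le` (`N_m(kuk⁻¹) ≤ N_(k⁻¹mk)(u)`) ·
  `norm_R_sub_self_le_comm_of_inv` (`‖R(u)m − m‖ ≤ N_m(u)`, only `‖u⁻¹‖ ≤ 1` needed) · `norm_R_inv_sub_self_le_comm_of_inv` · `comm_sub_one` (`N_m(u) = N_m` of `u − 1`) · ★ `comm_le_comm_add`
  (`N_m(u) ≤ N_(m′)(u) + 2‖u − 1‖·‖m − m′‖`: change of the element at the cost of a DIFFERENCE, not an absolute value) · `comm_list_prod_le` (`N_m(Π l) ≤ Σ N_m`).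
* §2 ★★★ `comm_chain_le`: for `g 0 = 1`, `g (k+1) = (T k * P k * (T k)⁻¹) * g k` with `T k`, `P k`, `g k` bi-contractive, `N_m(g n) ≤ Σ_(k<n) N_(R((T k)⁻¹) m)(P k)`;
  ★★ `norm_R_chain_sub_self_le` (the same for `‖R(g n)m − m‖`); `comm_chain_le_of_le` (with displayed per-rung bounds `N_(…)(P k) ≤ c k` ⇒ `≤ Σ c k`).
HONEST SCOPE.  Pure normed-ring algebra; no lattice, no background, no smallness.  The torus instances (straight ladder ⇒ the recursion of §2 with `T k` = straight transport,
`P k` = the plaquette at the `k`-th rung; comb loop = conjugated product of ≤ d − 1 straight ladders) are the next file (F-H9e), pens after the S3-CURVED verdict.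

References: T. Bałaban, CMP 98 (1985) 17–51 [Balaban1985Averaging] ((9) p.19, (19)–(20) p.21); CMP 99 (1985) 389–434 [Balaban1985BackgroundPropagators] ((3.3)–(3.4) pp.390–391).
-/

set_option autoImplicit false

noncomputable section

open scoped BigOperators

namespace Summit.QuantumFields.YangMills.Theorems.Prop7CommutatorChain

open Literature.MathematicalPhysics.QuantumFieldTheory.Balaban1983to89
open B9Eq39Adjoint (R R_def R_mul)
open Summit.QuantumFields.YangMills.Theorems.Prop7ConjFrameTransport (R_sub_self_eq_comm_mul R_inv_sub_self_eq_neg_mul_comm)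

variable {𝔸 : Type*} [NormedRing 𝔸]

/-! ## §1 The commutator currency on bi-contractive units -/

section Currency

/-- `N_m(1) = 0`. [folklore] -/
theorem comm_one [NormOneClass 𝔸] (m : 𝔸) : ‖((1 : 𝔸ˣ) : 𝔸) * m - m * ((1 : 𝔸ˣ) : 𝔸)‖ = 0 := by
  simp

/-- ★ **SUBADDITIVITY**: `N_m(uv) ≤ N_m(u) + N_m(v)` for bi-contractive `u, v` (`uvm − muv = u(vm − mv) + (um − mu)v`). [cite: Balaban1985Averaging, (19)-(20) p.21] -/
theorem comm_mul_le {u v : 𝔸ˣ} (hu : ‖(u : 𝔸)‖ ≤ 1 ∧ ‖((u⁻¹ : 𝔸ˣ) : 𝔸)‖ ≤ 1) (hv : ‖(v : 𝔸)‖ ≤ 1 ∧ ‖((v⁻¹ : 𝔸ˣ) : 𝔸)‖ ≤ 1) (m : 𝔸) :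
    ‖((u * v : 𝔸ˣ) : 𝔸) * m - m * ((u * v : 𝔸ˣ) : 𝔸)‖ ≤ ‖(u : 𝔸) * m - m * (u : 𝔸)‖ + ‖(v : 𝔸) * m - m * (v : 𝔸)‖ := by
  have e : ((u * v : 𝔸ˣ) : 𝔸) * m - m * ((u * v : 𝔸ˣ) : 𝔸) = (u : 𝔸) * ((v : 𝔸) * m - m * (v : 𝔸)) + ((u : 𝔸) * m - m * (u : 𝔸)) * (v : 𝔸) := by
    rw [Units.val_mul]; noncomm_ring
  rw [e]
  refine (norm_add_le _ _).trans ?_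
  rw [add_comm]
  refine add_le_add ?_ ?_
  · exact (norm_mul_le _ _).trans (by nlinarith [norm_nonneg ((u : 𝔸) * m - m * (u : 𝔸)), hv.1])
  · exact (norm_mul_le _ _).trans (by nlinarith [norm_nonneg ((v : 𝔸) * m - m * (v : 𝔸)), hu.1])

/-- `N_m(u⁻¹) ≤ N_m(u)` for bi-contractive `u` (`u⁻¹m − mu⁻¹ = −u⁻¹(um − mu)u⁻¹`). [folklore] -/
theorem comm_inv_le {u : 𝔸ˣ} (hu : ‖(u : 𝔸)‖ ≤ 1 ∧ ‖((u⁻¹ : 𝔸ˣ) : 𝔸)‖ ≤ 1) (m : 𝔸) :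
    ‖((u⁻¹ : 𝔸ˣ) : 𝔸) * m - m * ((u⁻¹ : 𝔸ˣ) : 𝔸)‖ ≤ ‖(u : 𝔸) * m - m * (u : 𝔸)‖ := by
  have hK : (u : 𝔸) * ((u⁻¹ : 𝔸ˣ) : 𝔸) = 1 := Units.mul_inv u
  have hK' : ((u⁻¹ : 𝔸ˣ) : 𝔸) * (u : 𝔸) = 1 := Units.inv_mul u
  have e : ((u⁻¹ : 𝔸ˣ) : 𝔸) * m - m * ((u⁻¹ : 𝔸ˣ) : 𝔸) = -(((u⁻¹ : 𝔸ˣ) : 𝔸) * ((u : 𝔸) * m - m * (u : 𝔸)) * ((u⁻¹ : 𝔸ˣ) : 𝔸)) := by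
    calc ((u⁻¹ : 𝔸ˣ) : 𝔸) * m - m * ((u⁻¹ : 𝔸ˣ) : 𝔸)
        = ((u⁻¹ : 𝔸ˣ) : 𝔸) * m * ((u : 𝔸) * ((u⁻¹ : 𝔸ˣ) : 𝔸)) - (((u⁻¹ : 𝔸ˣ) : 𝔸) * (u : 𝔸)) * m * ((u⁻¹ : 𝔸ˣ) : 𝔸) := by rw [hK, hK', mul_one, one_mul]
      _ = _ := by noncomm_ring
  rw [e, norm_neg]
  calc ‖((u⁻¹ : 𝔸ˣ) : 𝔸) * ((u : 𝔸) * m - m * (u : 𝔸)) * ((u⁻¹ : 𝔸ˣ) : 𝔸)‖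
      ≤ ‖((u⁻¹ : 𝔸ˣ) : 𝔸)‖ * ‖(u : 𝔸) * m - m * (u : 𝔸)‖ * ‖((u⁻¹ : 𝔸ˣ) : 𝔸)‖ :=
        (norm_mul_le _ _).trans (mul_le_mul_of_nonneg_right (norm_mul_le _ _) (norm_nonneg _))
    _ ≤ 1 * ‖(u : 𝔸) * m - m * (u : 𝔸)‖ * 1 :=
        mul_le_mul (mul_le_mul_of_nonneg_right hu.2 (norm_nonneg _)) hu.2 (norm_nonneg _) (by positivity)
    _ = ‖(u : 𝔸) * m - m * (u : 𝔸)‖ := by ring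

/-- ★ **CONJUGATION MOVES TO THE ELEMENT**: `N_m(kuk⁻¹) ≤ N_(k⁻¹mk)(u)` for bi-contractive `k` (`kuk⁻¹·m − m·kuk⁻¹ = k(u·(k⁻¹mk) − (k⁻¹mk)·u)k⁻¹`); `k⁻¹mk = R(k⁻¹)m`.
[cite: Balaban1985Averaging, (9) p.19, (19)-(20) p.21] -/
theorem comm_conj_le {k : 𝔸ˣ} (hk : ‖(k : 𝔸)‖ ≤ 1 ∧ ‖((k⁻¹ : 𝔸ˣ) : 𝔸)‖ ≤ 1) (u : 𝔸ˣ) (m : 𝔸) :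
    ‖((k * u * k⁻¹ : 𝔸ˣ) : 𝔸) * m - m * ((k * u * k⁻¹ : 𝔸ˣ) : 𝔸)‖ ≤ ‖(u : 𝔸) * R k⁻¹ m - R k⁻¹ m * (u : 𝔸)‖ := by
  have hK : (k : 𝔸) * ((k⁻¹ : 𝔸ˣ) : 𝔸) = 1 := Units.mul_inv k
  have e : ((k * u * k⁻¹ : 𝔸ˣ) : 𝔸) * m - m * ((k * u * k⁻¹ : 𝔸ˣ) : 𝔸) = (k : 𝔸) * ((u : 𝔸) * R k⁻¹ m - R k⁻¹ m * (u : 𝔸)) * ((k⁻¹ : 𝔸ˣ) : 𝔸) := by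
    rw [R_def, inv_inv, Units.val_mul, Units.val_mul]
    calc (k : 𝔸) * (u : 𝔸) * ((k⁻¹ : 𝔸ˣ) : 𝔸) * m - m * ((k : 𝔸) * (u : 𝔸) * ((k⁻¹ : 𝔸ˣ) : 𝔸))
        = (k : 𝔸) * (u : 𝔸) * ((k⁻¹ : 𝔸ˣ) : 𝔸) * m * ((k : 𝔸) * ((k⁻¹ : 𝔸ˣ) : 𝔸)) - ((k : 𝔸) * ((k⁻¹ : 𝔸ˣ) : 𝔸)) * m * ((k : 𝔸) * (u : 𝔸) * ((k⁻¹ : 𝔸ˣ) : 𝔸)) := by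
            rw [hK, mul_one, one_mul]
      _ = _ := by noncomm_ring
  rw [e]
  calc ‖(k : 𝔸) * ((u : 𝔸) * R k⁻¹ m - R k⁻¹ m * (u : 𝔸)) * ((k⁻¹ : 𝔸ˣ) : 𝔸)‖
      ≤ ‖(k : 𝔸)‖ * ‖(u : 𝔸) * R k⁻¹ m - R k⁻¹ m * (u : 𝔸)‖ * ‖((k⁻¹ : 𝔸ˣ) : 𝔸)‖ :=
        (norm_mul_le _ _).trans (mul_le_mul_of_nonneg_right (norm_mul_le _ _) (norm_nonneg _))
    _ ≤ 1 * ‖(u : 𝔸) * R k⁻¹ m - R k⁻¹ m * (u : 𝔸)‖ * 1 := mul_le_mul (mul_le_mul_of_nonneg_right hk.1 (norm_nonneg _)) hk.2 (norm_nonneg _) (by positivity)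
    _ = _ := by ring

/-- the commutator sees only `u − 1`: `um − mu = (u − 1)m − m(u − 1)`. [folklore] -/
theorem comm_sub_one (u m : 𝔸) : u * m - m * u = (u - 1) * m - m * (u - 1) := by noncomm_ring

/-- `‖R(u)m − m‖ ≤ N_m(u)` as soon as `‖u⁻¹‖ ≤ 1` (✓ `R_sub_self_eq_comm_mul`; the bi-contractive case is ★routeR-w4's ✓ `Prop7LemmaHCurvedTransportRow.norm_R_sub_self_le_comm`).
[cite: Balaban1985BackgroundPropagators, (3.3) p.390] -/
theorem norm_R_sub_self_le_comm_of_inv {u : 𝔸ˣ} (hu : ‖((u⁻¹ : 𝔸ˣ) : 𝔸)‖ ≤ 1) (m : 𝔸) :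
    ‖R u m - m‖ ≤ ‖(u : 𝔸) * m - m * (u : 𝔸)‖ := by
  rw [R_sub_self_eq_comm_mul, ← comm_sub_one]
  exact (norm_mul_le _ _).trans (by nlinarith [norm_nonneg ((u : 𝔸) * m - m * (u : 𝔸)), hu])

/-- `‖R(u⁻¹)m − m‖ ≤ N_m(u)` as soon as `‖u⁻¹‖ ≤ 1` (✓ `R_inv_sub_self_eq_neg_mul_comm`). [cite: Balaban1985BackgroundPropagators, (3.3) p.390] -/
theorem norm_R_inv_sub_self_le_comm_of_inv {u : 𝔸ˣ} (hu : ‖((u⁻¹ : 𝔸ˣ) : 𝔸)‖ ≤ 1) (m : 𝔸) :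
    ‖R u⁻¹ m - m‖ ≤ ‖(u : 𝔸) * m - m * (u : 𝔸)‖ := by
  rw [R_inv_sub_self_eq_neg_mul_comm, ← comm_sub_one, norm_neg]
  exact (norm_mul_le _ _).trans (by nlinarith [norm_nonneg ((u : 𝔸) * m - m * (u : 𝔸)), hu])

/-- ★ **CHANGING THE ELEMENT COSTS A DIFFERENCE**: `N_m(u) ≤ N_(m′)(u) + 2‖u − 1‖·‖m − m′‖` — the junction from the transported centre value `m` to the local value `m′ = φ₀(x_p)`
pays `‖u − 1‖` (a plaquette: `≤ a`) times a DIFFERENCE of the potential, never its absolute value. [cite: Balaban1985BackgroundPropagators, (3.3)-(3.4) pp.390-391] -/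
theorem comm_le_comm_add (u m m' : 𝔸) : ‖u * m - m * u‖ ≤ ‖u * m' - m' * u‖ + 2 * ‖u - 1‖ * ‖m - m'‖ := by
  have e : u * m - m * u = (u * m' - m' * u) + ((u - 1) * (m - m') - (m - m') * (u - 1)) := by noncomm_ring
  rw [e]
  refine (norm_add_le _ _).trans (add_le_add le_rfl ?_)
  refine (norm_sub_le _ _).trans ?_
  have h1 := norm_mul_le (u - 1) (m - m')
  have h2 := norm_mul_le (m - m') (u - 1)
  linarith

/-- subadditivity along a list: `N_m(Π l) ≤ Σ_(u∈l) N_m(u)` for a list of bi-contractive units. [folklore] -/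
theorem comm_list_prod_le (m : 𝔸) [NormOneClass 𝔸] :
    ∀ (l : List 𝔸ˣ), (∀ u ∈ l, ‖(u : 𝔸)‖ ≤ 1 ∧ ‖((u⁻¹ : 𝔸ˣ) : 𝔸)‖ ≤ 1) →
      ‖((l.prod : 𝔸ˣ) : 𝔸) * m - m * ((l.prod : 𝔸ˣ) : 𝔸)‖ ≤ (l.map fun u : 𝔸ˣ => ‖(u : 𝔸) * m - m * (u : 𝔸)‖).sum
  | [], _ => by simp
  | u :: l, h => by
    rw [List.prod_cons, List.map_cons, List.sum_cons]
    have hu := h u (by simp)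
    have hl : ∀ v ∈ l, ‖(v : 𝔸)‖ ≤ 1 ∧ ‖((v⁻¹ : 𝔸ˣ) : 𝔸)‖ ≤ 1 := fun v hv => h v (by simp [hv])
    have hprod : ‖((l.prod : 𝔸ˣ) : 𝔸)‖ ≤ 1 ∧ ‖(((l.prod)⁻¹ : 𝔸ˣ) : 𝔸)‖ ≤ 1 := by
      clear h hu
      induction l with
      | nil => simp
      | cons v l ih =>
        have hv := hl v (by simp)
        have hl' : ∀ w ∈ l, ‖(w : 𝔸)‖ ≤ 1 ∧ ‖((w⁻¹ : 𝔸ˣ) : 𝔸)‖ ≤ 1 := fun w hw => hl w (by simp [hw])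
        obtain ⟨i1, i2⟩ := ih hl'
        refine ⟨?_, ?_⟩
        · rw [List.prod_cons, Units.val_mul]
          exact (norm_mul_le _ _).trans (by nlinarith [hv.1, norm_nonneg (v : 𝔸), norm_nonneg ((l.prod : 𝔸ˣ) : 𝔸)])
        · rw [List.prod_cons, mul_inv_rev, Units.val_mul]
          exact (norm_mul_le _ _).trans (by nlinarith [hv.2, norm_nonneg ((v⁻¹ : 𝔸ˣ) : 𝔸), norm_nonneg (((l.prod)⁻¹ : 𝔸ˣ) : 𝔸)])
    exact (comm_mul_le hu hprod m).trans (add_le_add le_rfl (comm_list_prod_le m l hl))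

end Currency

/-! ## §2 The chain rule: a thin loop built rung by rung -/

section Chain

/-- ★★★ **THE CHAIN RULE IN COMMUTATOR CURRENCY**: if `g 0 = 1` and `g (k+1) = (T k · P k · (T k)⁻¹) · g k` (a thin loop grown one conjugated plaquette per rung), all units
bi-contractive, then `N_m(g n) ≤ Σ_(k<n) N_(R((T k)⁻¹)m)(P k)` — the commutators of the TRANSPORTED element with the rungs' plaquettes. [cite: Balaban1985Averaging, (9) p.19, (19)-(20) p.21] -/
theorem comm_chain_le (T P g : ℕ → 𝔸ˣ) (hT : ∀ k, ‖(T k : 𝔸)‖ ≤ 1 ∧ ‖(((T k)⁻¹ : 𝔸ˣ) : 𝔸)‖ ≤ 1)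
    (hP : ∀ k, ‖(P k : 𝔸)‖ ≤ 1 ∧ ‖(((P k)⁻¹ : 𝔸ˣ) : 𝔸)‖ ≤ 1) (hg : ∀ k, ‖(g k : 𝔸)‖ ≤ 1 ∧ ‖(((g k)⁻¹ : 𝔸ˣ) : 𝔸)‖ ≤ 1)
    (h0 : g 0 = 1) (hs : ∀ k, g (k + 1) = (T k * P k * (T k)⁻¹) * g k) (m : 𝔸) [NormOneClass 𝔸] :
    ∀ n : ℕ, ‖(g n : 𝔸) * m - m * (g n : 𝔸)‖ ≤ ∑ k ∈ Finset.range n, ‖(P k : 𝔸) * R (T k)⁻¹ m - R (T k)⁻¹ m * (P k : 𝔸)‖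
  | 0 => by rw [h0]; simp
  | n + 1 => by
    rw [hs n, Finset.sum_range_succ]
    have hconj : ‖((T n * P n * (T n)⁻¹ : 𝔸ˣ) : 𝔸)‖ ≤ 1 ∧ ‖(((T n * P n * (T n)⁻¹)⁻¹ : 𝔸ˣ) : 𝔸)‖ ≤ 1 := by
      refine ⟨?_, ?_⟩
      · rw [Units.val_mul, Units.val_mul]
        calc ‖(T n : 𝔸) * (P n : 𝔸) * (((T n)⁻¹ : 𝔸ˣ) : 𝔸)‖ ≤ ‖(T n : 𝔸)‖ * ‖(P n : 𝔸)‖ * ‖(((T n)⁻¹ : 𝔸ˣ) : 𝔸)‖ :=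
              (norm_mul_le _ _).trans (mul_le_mul_of_nonneg_right (norm_mul_le _ _) (norm_nonneg _))
          _ ≤ 1 * 1 * 1 := mul_le_mul (mul_le_mul (hT n).1 (hP n).1 (norm_nonneg _) zero_le_one) (hT n).2 (norm_nonneg _) (by positivity)
          _ = 1 := by ring
      · rw [mul_inv_rev, mul_inv_rev, inv_inv, Units.val_mul, Units.val_mul]
        calc ‖(T n : 𝔸) * ((((P n)⁻¹ : 𝔸ˣ) : 𝔸) * (((T n)⁻¹ : 𝔸ˣ) : 𝔸))‖ ≤ ‖(T n : 𝔸)‖ * (‖(((P n)⁻¹ : 𝔸ˣ) : 𝔸)‖ * ‖(((T n)⁻¹ : 𝔸ˣ) : 𝔸)‖) :=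
              (norm_mul_le _ _).trans (mul_le_mul_of_nonneg_left (norm_mul_le _ _) (norm_nonneg _))
          _ ≤ 1 * (1 * 1) := mul_le_mul (hT n).1 (mul_le_mul (hP n).2 (hT n).2 (norm_nonneg _) zero_le_one) (by positivity) zero_le_one
          _ = 1 := by ring
    calc ‖((T n * P n * (T n)⁻¹ * g n : 𝔸ˣ) : 𝔸) * m - m * ((T n * P n * (T n)⁻¹ * g n : 𝔸ˣ) : 𝔸)‖
        ≤ ‖((T n * P n * (T n)⁻¹ : 𝔸ˣ) : 𝔸) * m - m * ((T n * P n * (T n)⁻¹ : 𝔸ˣ) : 𝔸)‖ + ‖(g n : 𝔸) * m - m * (g n : 𝔸)‖ := comm_mul_le hconj (hg n) m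
      _ ≤ ‖(P n : 𝔸) * R (T n)⁻¹ m - R (T n)⁻¹ m * (P n : 𝔸)‖ + ∑ k ∈ Finset.range n, ‖(P k : 𝔸) * R (T k)⁻¹ m - R (T k)⁻¹ m * (P k : 𝔸)‖ :=
          add_le_add (comm_conj_le (hT n) (P n) m) (comm_chain_le T P g hT hP hg h0 hs m n)
      _ = _ := add_comm _ _

/-- ★★ the same read on the conjugation: `‖R(g n)m − m‖ ≤ Σ_(k<n) N_(R((T k)⁻¹)m)(P k)`. [cite: Balaban1985BackgroundPropagators, (3.3) p.390] -/
theorem norm_R_chain_sub_self_le (T P g : ℕ → 𝔸ˣ) (hT : ∀ k, ‖(T k : 𝔸)‖ ≤ 1 ∧ ‖(((T k)⁻¹ : 𝔸ˣ) : 𝔸)‖ ≤ 1)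
    (hP : ∀ k, ‖(P k : 𝔸)‖ ≤ 1 ∧ ‖(((P k)⁻¹ : 𝔸ˣ) : 𝔸)‖ ≤ 1) (hg : ∀ k, ‖(g k : 𝔸)‖ ≤ 1 ∧ ‖(((g k)⁻¹ : 𝔸ˣ) : 𝔸)‖ ≤ 1)
    (h0 : g 0 = 1) (hs : ∀ k, g (k + 1) = (T k * P k * (T k)⁻¹) * g k) (m : 𝔸) [NormOneClass 𝔸] (n : ℕ) :
    ‖R (g n) m - m‖ ≤ ∑ k ∈ Finset.range n, ‖(P k : 𝔸) * R (T k)⁻¹ m - R (T k)⁻¹ m * (P k : 𝔸)‖ :=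
  (norm_R_sub_self_le_comm_of_inv (hg n).2 m).trans (comm_chain_le T P g hT hP hg h0 hs m n)

/-- the chain rule with DISPLAYED per-rung bounds: `N_(R((T k)⁻¹)m)(P k) ≤ c k` for `k < n` ⇒ `N_m(g n) ≤ Σ_(k<n) c k`. [cite: Balaban1985Averaging, (19)-(20) p.21] -/
theorem comm_chain_le_of_le (T P g : ℕ → 𝔸ˣ) (hT : ∀ k, ‖(T k : 𝔸)‖ ≤ 1 ∧ ‖(((T k)⁻¹ : 𝔸ˣ) : 𝔸)‖ ≤ 1)
    (hP : ∀ k, ‖(P k : 𝔸)‖ ≤ 1 ∧ ‖(((P k)⁻¹ : 𝔸ˣ) : 𝔸)‖ ≤ 1) (hg : ∀ k, ‖(g k : 𝔸)‖ ≤ 1 ∧ ‖(((g k)⁻¹ : 𝔸ˣ) : 𝔸)‖ ≤ 1)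
    (h0 : g 0 = 1) (hs : ∀ k, g (k + 1) = (T k * P k * (T k)⁻¹) * g k) (m : 𝔸) [NormOneClass 𝔸] (n : ℕ) (c : ℕ → ℝ)
    (hc : ∀ k, k < n → ‖(P k : 𝔸) * R (T k)⁻¹ m - R (T k)⁻¹ m * (P k : 𝔸)‖ ≤ c k) :
    ‖(g n : 𝔸) * m - m * (g n : 𝔸)‖ ≤ ∑ k ∈ Finset.range n, c k :=
  (comm_chain_le T P g hT hP hg h0 hs m n).trans (Finset.sum_le_sum fun k hk => hc k (Finset.mem_range.mp hk))

end Chain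

end Summit.QuantumFields.YangMills.Theorems.Prop7CommutatorChain

end
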